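import Summits.Ventures.PercRepro.ProfilePointedGirth

/-!
# PercRepro — THE CAPTURED-PROFILE FORM OF THE POINTED CONJECTURE: `in_k = c_{k−1} + κ_{N−k}`,
`P_k = c_{k−1} + c_k + κ_k + κ_{N−k}`, AND (Ĉ) IS EXACTLY A ROW INEQUALITY OF THE CAPTURED PROFILE (p10, gen 25)

For a finite matroid `M` on `N` elements and a point `p`: `c_k = c^p_k` (`extCount`, `= P_k(M / p)`), `κ_k` (`capCount`,
the `p`-avoiding bi-independent `k`-sets capturing `p`), `in_k` / `out_k` (`inCount` / `outCount`).  Gen 15 proved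
`out_k = κ_k + c_k`.  THIS FILE adds the mirror identity and the exact form of (Ĉ):

* `mem_biIndepSets_sdiff_iff` — complementation, `X ∈ BI_k ↔ E ∖ X ∈ BI_{N−k}` (membership form of gen 9's bijection);
* `erase_mem_biIndepSets_iff` — for `X ∈ BI_k` through `p`: `X ∖ p ∈ BI_{k−1} ↔ p ∉ cl(E ∖ X)`;
* `inCount_eq_extCount_add_capCount_mirror` — **`in_k = c_{k−1} + κ_{N−k}`**: a bi-independent `k`-set through `p`
  either is `Z ∪ p` for an extendable `Z ∈ BI_{k−1}` or has a complement capturing `p` — a `p`-avoiding set of size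
  `N − k` capturing `p`;
* `card_biIndepSets_eq_capForm` — **`P_k = c_{k−1} + c_k + κ_k + κ_{N−k}`** — gen 12's free-coextension identity
  `P_k(M̂) = P_k(M₀) + P_{k−1}(M₀) + S_k(M₀)` for an ARBITRARY coextension `M` of `M₀ = M / p` (the captured sets are the
  unicyclic sets of `M₀` whose circuit `C` has `C ∪ p` a circuit of `M`, with independent complement);
* `pointedRow_level_iff_capForm` — **(Ĉ) at `(M, p, k)` ⟺ `(N − k − 1)·(c_{k−1} + κ_k + κ_{N−k}) ≤ k·(c_{k+1} + κ_{k+1} +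
  κ_{N−k−1})`** (the `c_k` terms cancel exactly): (Ĉ) for all pointed matroids IS `RowAll` for all co-linear-subclasses —
  `∅` (p a coloop) is the two-step Theorem A, all circuits (the free coextension) is `RowAll`.

With `extCount_thmA_of_fact` the `c`-part `(N − k − 1)·c_{k−1} ≤ k·c_{k+1}` is the two-step Theorem A of `M / p`, so (Ĉ)
asks the symmetrised captured profile `κ_k + κ_{N−k}` to be Theorem-A-minus-one-monotone up to that slack; the
`c`-free form `(N−k−1)(κ_k + κ_{N−k}) ≤ k(κ_{k+1} + κ_{N−k−1})` is FALSE (already on 4 elements) — the slack is needed.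
Nothing here asserts (Ĉ).
-/

open scoped Matroid

namespace PercRepro.Cogirth

open Finset ThmH Skew

variable {α : Type} [DecidableEq α] {M : Matroid α} [M.Finite]

/-- Complementation: `X ∈ BI_k ↔ E ∖ X ∈ BI_{N−k}` for `X ⊆ E`, `#X = k`. -/
theorem mem_biIndepSets_sdiff_iff {k : ℕ} {X : Finset α} (hX : X ⊆ gr M) (hXc : X.card = k) :
    gr M \ X ∈ biIndepSets M ((gr M).card - k) ↔ X ∈ biIndepSets M k := by
  rw [mem_biIndepSets, mem_biIndepSets, Finset.sdiff_sdiff_eq_self hX, card_sdiff_of_subset hX]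
  constructor
  · rintro ⟨-, -, h1, h2⟩
    exact ⟨hX, hXc, h2, h1⟩
  · rintro ⟨-, -, h1, h2⟩
    exact ⟨sdiff_subset, by rw [hXc], h2, h1⟩

/-- For a bi-independent `k`-set `X` through `p`: `X ∖ p ∈ BI_{k−1} ↔ p ∉ cl(E ∖ X)`. -/
theorem erase_mem_biIndepSets_iff {k : ℕ} {X : Finset α} (hX : X ∈ biIndepSets M (k + 1)) {p : α} (hp : p ∈ gr M)
    (hpX : p ∈ X) : X.erase p ∈ biIndepSets M k ↔ p ∉ clF M (gr M \ X) := by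
  have hXg := (mem_biIndepSets.1 hX).1
  have hXc := (mem_biIndepSets.1 hX).2.1
  have hY : gr M \ X ∈ biIndepSets M ((gr M).card - (k + 1)) := (mem_biIndepSets_sdiff_iff hXg hXc).2 hX
  have hpY : p ∉ gr M \ X := fun h => (mem_sdiff.1 h).2 hpX
  have h1 := insert_mem_biIndepSets_iff hY hp hpY
  have h2 : insert p (gr M \ X) = gr M \ X.erase p := (sdiff_erase hp).symm
  rw [h2] at h1
  have hk : (gr M).card - (k + 1) + 1 = (gr M).card - k := by
    have := card_le_card hXg
    omega
  rw [hk] at h1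
  rw [← h1]
  have hXe : X.erase p ⊆ gr M := (erase_subset p X).trans hXg
  have hXec : (X.erase p).card = k := by rw [card_erase_of_mem hpX, hXc]; rfl
  exact (mem_biIndepSets_sdiff_iff hXe hXec).symm

/-- **`in_k = c_{k−1} + κ_{N−k}`** for `1 ≤ k ≤ N`. -/
theorem inCount_eq_extCount_add_capCount_mirror {p : α} (hp : p ∈ gr M) (k : ℕ) (hk : 1 ≤ k)
    (hkN : k ≤ (gr M).card) :
    inCount M k p = extCount M (k - 1) p + capCount M ((gr M).card - k) p := by
  obtain ⟨j, rfl⟩ : ∃ j, k = j + 1 := ⟨k - 1, by omega⟩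
  rw [show j + 1 - 1 = j by omega]
  unfold inCount
  have hsplit := card_filter_add_card_filter_not (s := (biIndepSets M (j + 1)).filter (fun X => p ∈ X))
    (fun X => p ∉ clF M (gr M \ X))
  rw [filter_filter, filter_filter] at hsplit
  rw [← hsplit]
  congr 1
  · -- the sets through `p` whose complement does not capture `p` ↔ the extendable `j`-sets, via `X ↦ X ∖ p`
    unfold extCount
    symm
    apply card_bij (fun Z _ => insert p Z)
    · intro Z hZ
      rw [mem_filter] at hZ ⊢
      obtain ⟨hZk, hpZ, hins⟩ := hZ
      refine ⟨hins, mem_insert_self p Z, ?_⟩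
      have h := erase_mem_biIndepSets_iff hins hp (mem_insert_self p Z)
      rw [erase_insert hpZ] at h
      exact h.1 hZk
    · intro Z₁ hZ₁ Z₂ hZ₂ h
      rw [mem_filter] at hZ₁ hZ₂
      have := congrArg (fun S => S.erase p) h
      rwa [erase_insert hZ₁.2.1, erase_insert hZ₂.2.1] at this
    · intro X hX
      rw [mem_filter] at hX
      obtain ⟨hXk, hpX, hcl⟩ := hX
      refine ⟨X.erase p, ?_, insert_erase hpX⟩
      rw [mem_filter]
      refine ⟨(erase_mem_biIndepSets_iff hXk hp hpX).2 hcl, notMem_erase p X, ?_⟩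
      rwa [insert_erase hpX]
  · -- the sets through `p` whose complement captures `p` ↔ the captured sets of size `N − (j+1)`, via complementation
    unfold capCount
    apply card_bij (fun X _ => gr M \ X)
    · intro X hX
      rw [mem_filter] at hX ⊢
      obtain ⟨hXk, hpX, hcl⟩ := hX
      have hXg := (mem_biIndepSets.1 hXk).1
      have hXc := (mem_biIndepSets.1 hXk).2.1
      refine ⟨(mem_biIndepSets_sdiff_iff hXg hXc).2 hXk, fun h => (mem_sdiff.1 h).2 hpX, ?_⟩
      exact not_not.1 hcl
    · intro X₁ hX₁ X₂ hX₂ h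
      rw [mem_filter] at hX₁ hX₂
      have h₁ := (mem_biIndepSets.1 hX₁.1).1
      have h₂ := (mem_biIndepSets.1 hX₂.1).1
      rw [← Finset.sdiff_sdiff_eq_self h₁, ← Finset.sdiff_sdiff_eq_self h₂, h]
    · intro Y hY
      rw [mem_filter] at hY
      obtain ⟨hYk, hpY, hcl⟩ := hY
      have hYg := (mem_biIndepSets.1 hYk).1
      have hYc := (mem_biIndepSets.1 hYk).2.1
      refine ⟨gr M \ Y, ?_, Finset.sdiff_sdiff_eq_self hYg⟩
      rw [mem_filter]
      have hYc' : (gr M \ Y).card = j + 1 := by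
        rw [card_sdiff_of_subset hYg, hYc]
        have := card_le_card hYg
        omega
      refine ⟨?_, mem_sdiff.2 ⟨hp, hpY⟩, ?_⟩
      · have := (mem_biIndepSets_sdiff_iff sdiff_subset hYc').1
        rw [Finset.sdiff_sdiff_eq_self hYg] at this
        exact this hYk
      · rw [Finset.sdiff_sdiff_eq_self hYg]
        exact not_not.2 hcl

/-- **`P_k = c_{k−1} + c_k + κ_k + κ_{N−k}`** for `1 ≤ k ≤ N`. -/
theorem card_biIndepSets_eq_capForm {p : α} (hp : p ∈ gr M) (k : ℕ) (hk : 1 ≤ k) (hkN : k ≤ (gr M).card) :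
    (biIndepSets M k).card =
      extCount M (k - 1) p + extCount M k p + capCount M k p + capCount M ((gr M).card - k) p := by
  rw [← inCount_add_outCount M k p, inCount_eq_extCount_add_capCount_mirror hp k hk hkN,
    ← capCount_add_extCount k hp]
  ring

/-- **(Ĉ) AT `(M, p, k)` IS EXACTLY A ROW INEQUALITY OF THE CAPTURED PROFILE** (the `c_k` terms cancel): for
`1 ≤ k`, `2k + 2 ≤ N`, `(N − k − 1)·P_k ≤ k·P_{k+1} + (N − 2k − 1)·c_k ↔
(N − k − 1)·(c_{k−1} + κ_k + κ_{N−k}) ≤ k·(c_{k+1} + κ_{k+1} + κ_{N−k−1})`. -/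
theorem pointedRow_level_iff_capForm {p : α} (hp : p ∈ gr M) {k : ℕ} (hk1 : 1 ≤ k) (hk : 2 * k + 2 ≤ (gr M).card) :
    (((gr M).card - k - 1) * (biIndepSets M k).card ≤
      k * (biIndepSets M (k + 1)).card + ((gr M).card - 2 * k - 1) * extCount M k p) ↔
    (((gr M).card - k - 1) * (extCount M (k - 1) p + capCount M k p + capCount M ((gr M).card - k) p) ≤
      k * (extCount M (k + 1) p + capCount M (k + 1) p + capCount M ((gr M).card - k - 1) p)) := by
  rw [card_biIndepSets_eq_capForm hp k hk1 (by omega), card_biIndepSets_eq_capForm hp (k + 1) (by omega) (by omega)]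
  rw [show k + 1 - 1 = k by omega, show (gr M).card - (k + 1) = (gr M).card - k - 1 by omega]
  have hsplit : (gr M).card - k - 1 = ((gr M).card - 2 * k - 1) + k := by omega
  generalize extCount M (k - 1) p = a
  generalize extCount M k p = b
  generalize extCount M (k + 1) p = c
  generalize capCount M k p = u
  generalize capCount M ((gr M).card - k) p = v
  generalize capCount M (k + 1) p = u'
  generalize capCount M ((gr M).card - k - 1) p = v'
  rw [hsplit]
  generalize (gr M).card - 2 * k - 1 = m
  constructor
  · intro h
    nlinarith [h]
  · intro h
    nlinarith [h]

end PercRepro.Cogirth
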